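import Summits.HodgeConjecture.HodgeConjecture.Cruxes.BlochSeedDiscOne.SigmaH
import Summits.HodgeConjecture.HodgeConjecture.Cruxes.BlochSeedDiscOne.MinMassWindowH14
import Summits.HodgeConjecture.HodgeConjecture.Cruxes.BlochSeedDiscOne.AxisPhaseTorus

/-!
line stmt-HodgeConjecture-18881 Cruxes/BlochSeedDiscOne/Lines/birth.lean 814a6a70c14e831a stub_rung_pad4_seedAt

# OffAxisCheap — (A1) IS NECESSARY OFF THE AXIS TOO: an explicit OFF-AXIS design `C°` meeting `RuleD` (both clauses), `Disj`, `HallUp`,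
# `HallPlusUp 8`, `μ = −1 ≠ 0`, N-mass `49 ≤ 58` and the Σ-budget of record — violating ONLY (A1)
(plan-lens-HodgeAV-strengthen g22, 2026-08-31; STRENGTHEN-MEMO-32 §4.5; S⁺-ledger v1.46 row #241; companion of `OffAxisTwin.lean` (the
RULE-D-free off-axis twins `D°`, `D◇`) and of g21's axis inhabitant `C⋆` (`AxisRuleDCheap.lean`).)

HONEST LABEL.  Nothing here is proved toward HC / HC_CM / HC_AV / №4 / 26512 / 18881 / H2; letters ≠ sheaves ≠ SEED.  `C°` FAILS the
door (it is not (A1)-clean), so it is census-neutral: it shows that OFF the axis room, exactly as on it, the RULE-D closure of a charged cell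
is CHEAP, so the wanted off-axis N-mass law (`SPlus 14 σ_H 0` off the axis ⟺ N-mass ≥ 59 for off-axis door designs) must run on (A1)
— and, by `OffAxisTwin`, on `RuleD` — jointly.

THE DESIGN.  `C°` is the closure of the hub-free P-cell `u⁴`, `u = (13;1,0)`, under both RULE-D clauses and `Disj`, computed by a beam
search over partner cells with letters of level ≥ 11 (`eng/afree_greedy.py 11 40 … uuuu`): 42 cells — `31·hub⁴` + 18 N-cells (11 of them
with an off-axis letter) and 23 P-cells (unit multiplicities); P-mass 23, so the heavy hub `31 = 23 + 8` gives PortHall₈ by itself and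
N-mass `18 + 31 = 49`.  (With the exact Hall multiplicity `13` — maximum matching 18 of the 23 P-cells into distinct non-hub N-cells weakly
above them — the same support is a door-minus-(A1) inhabitant of N-mass `31`; script level only.)  `μ = −1` (the seed is the only fully
charged cell), all four Σ-H digits vanish, `σ_H = 2016`, budget `2632 ≤ 3136`; (A1) fails at the mixed word `1·1·1·e` (`T = (−7, −5)`).

KERNEL CERTIFICATE.  RULE D by the SOUND raw checker `ruleD_of_B` (§1, the text of `AxisRuleDCheap` §1, copied because that module is
not built on the farm this generation), `decide +kernel` tables for alphabet ∕ disjointness ∕ hub domination ∕ masses ∕ digits ∕ two raw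
tensor rows, and the heavy-hub surplus argument.  0 sorry, standard axioms.
-/

set_option linter.dupNamespace false
set_option autoImplicit false
set_option maxRecDepth 16384

namespace Summit.HodgeConjecture.HodgeConjecture.Cruxes.BlochSeedDiscOne.OffAxisCheap

open Summit.HodgeConjecture.HodgeConjecture.Cruxes.BlochSeedDiscOne.DepthBoundA4
open Summit.HodgeConjecture.HodgeConjecture.Cruxes.BlochSeedDiscOne.HeightTower
open Summit.HodgeConjecture.HodgeConjecture.Cruxes.BlochSeedDiscOne.LeggedFloor (NullStep Supplies Detects RuleDP RuleD Disj)
open Summit.HodgeConjecture.HodgeConjecture.Cruxes.BlochSeedDiscOne.HallB136 (HallUp notDeadB weakLiveB weakLiveB_of)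
open Summit.HodgeConjecture.HodgeConjecture.Cruxes.BlochSeedDiscOne.RuleDPlate
  (HallPlusUp hallUp_of_hallPlusUp hallUp_shiftD hallPlusUp_shiftD disj_shiftD ruleD_shiftD BudgetClause budgetClause_shiftD SPlusB SPlus)
open Summit.HodgeConjecture.HodgeConjecture.Cruxes.BlochSeedDiscOne.SigmaH (sigmaH extPN extNP extNN extPP sigmaH_shiftD)
open Summit.HodgeConjecture.HodgeConjecture.Cruxes.BlochSeedDiscOne.MinMassWindowH14
  (toG rawT T_raw allB allB_iff anyB anyB_iff cellOf allWords mem_allWords efreeB efree_of_efreeB efreeB_of_efree blochB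
   bloch_of_blochB degB deg_eq_degB onAlphaB onAlphabet_of_B mem_suppN_of mem_suppP_of exists_of_mem_suppN exists_of_mem_suppP
   cellEqB cellEqB_self nullStepB stepB fins mem_fins suppliesB suppliesB_of)
open Summit.HodgeConjecture.HodgeConjecture.Cruxes.BlochSeedDiscOne.AxisPhaseTorus (AxisCell AxisRoom)

/-! ## §1 Generic lemmas (soundness of the raw tests; text of `AxisRuleDCheap` §1 ∕ `OffAxisTwin` §1) -/

theorem nullStep_of_B {ℓ ℓ' : Letter} (h : nullStepB ℓ ℓ' = true) : NullStep ℓ ℓ' := by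
  simp only [nullStepB, Bool.and_eq_true, decide_eq_true_eq] at h
  exact ⟨h.1, h.2⟩

theorem step_of_B {ℓ ℓ' : Letter} (h : stepB ℓ ℓ' = true) : ℓ = ℓ' ∨ NullStep ℓ ℓ' := by
  simp only [stepB, Bool.or_eq_true, decide_eq_true_eq] at h
  rcases h with h | h
  · exact Or.inl h
  · exact Or.inr (nullStep_of_B h)

/-- the raw supplier test is SOUND (its completeness `suppliesB_of` is `MinMassWindowH14`'s). -/
theorem supplies_of_B {x y : Cell} {g j : Fin 4} (h : suppliesB x y g j = true) : Supplies x y g j := by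
  simp only [suppliesB, Bool.and_eq_true] at h
  obtain ⟨⟨hoff, hg⟩, hj⟩ := h
  refine ⟨?_, step_of_B hg, step_of_B hj⟩
  intro f hfg hfj
  have hf := (allB_iff _ _).1 hoff f (mem_fins f)
  simp only [Bool.or_eq_true, decide_eq_true_eq] at hf
  rcases hf with (hf | hf) | hf
  · exact absurd hf hfg
  · exact absurd hf hfj
  · exact hf

/-- raw DETECTS test. -/
def detectsB (c : Cell) (g j : Fin 4) : Bool :=
  !(decide ((c g).x = 0) && decide ((c g).y = 0) && decide ((c j).x = 0) && decide ((c j).y = 0) && decide ((c g).a = (c j).a))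

theorem detectsB_of {c : Cell} {g j : Fin 4} (h : Detects c g j) : detectsB c g j = true := by
  unfold Detects at h
  simp only [detectsB, Bool.not_eq_true', Bool.and_eq_false_iff, decide_eq_false_iff_not]
  by_contra hc
  simp only [not_or, not_not] at hc
  exact h ⟨hc.1.1.1.1, hc.1.1.1.2, hc.1.1.2, hc.1.2, hc.2⟩

/-- the six blocks `g < j`. -/
def blocks : List (Fin 4 × Fin 4) := [(0, 1), (0, 2), (0, 3), (1, 2), (1, 3), (2, 3)]

theorem mem_blocks : ∀ g j : Fin 4, g < j → (g, j) ∈ blocks := by decide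

/-- raw RULE-D checker: every entry of `X` whose block detects has, among the POSITIVE-mass entries of `Y`, a raw supplier (N-side: `Y` above;
P-side: `Y` below — the direction is carried by the test passed in). -/
def closedB (X Y : List (Cell × ℕ)) (t : Cell → Cell → Fin 4 → Fin 4 → Bool) : Bool :=
  allB X fun cx => allB blocks fun b => !detectsB cx.1 b.1 b.2 || anyB Y fun cy => decide (0 < cy.2) && t cy.1 cx.1 b.1 b.2

/-- SOUNDNESS of the raw RULE-D checker. -/
theorem ruleD_of_B (E : Design)
    (hN : closedB E.N E.P (fun x y g j => suppliesB x y g j) = true)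
    (hP : closedB E.P E.N (fun y x g j => suppliesB x y g j) = true) : RuleD E := by
  constructor
  · intro y hy g j hgj hdet
    obtain ⟨m, hm⟩ := exists_of_mem_suppN hy
    have h1 := (allB_iff _ _).1 ((allB_iff _ _).1 hN (y, m) hm) (g, j) (mem_blocks g j hgj)
    simp only [Bool.or_eq_true, Bool.not_eq_true', detectsB_of hdet] at h1
    rcases h1 with h1 | h1
    · exact Bool.noConfusion h1
    · obtain ⟨cx, hcx, hb⟩ := (anyB_iff _ _).1 h1
      simp only [Bool.and_eq_true, decide_eq_true_eq] at hb
      exact ⟨cx.1, mem_suppP_of (by simpa using hcx) hb.1, supplies_of_B hb.2⟩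
  · intro x hx g j hgj hdet
    obtain ⟨m, hm⟩ := exists_of_mem_suppP hx
    have h1 := (allB_iff _ _).1 ((allB_iff _ _).1 hP (x, m) hm) (g, j) (mem_blocks g j hgj)
    simp only [Bool.or_eq_true, Bool.not_eq_true', detectsB_of hdet] at h1
    rcases h1 with h1 | h1
    · exact Bool.noConfusion h1
    · obtain ⟨cy, hcy, hb⟩ := (anyB_iff _ _).1 h1
      simp only [Bool.and_eq_true, decide_eq_true_eq] at hb
      exact ⟨cy.1, mem_suppN_of (by simpa using hcy) hb.1, supplies_of_B hb.2⟩

theorem notDead_of_notDeadB {ℓ ℓ' : Letter} (h : notDeadB ℓ ℓ' = true) : NotDead ℓ ℓ' := by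
  simp only [notDeadB, Bool.or_eq_true, Bool.and_eq_true, decide_eq_true_eq] at h
  rcases h with ⟨⟨ha, hx⟩, hy⟩ | ⟨ha, hb⟩
  · left
    obtain ⟨a, x, y⟩ := ℓ
    obtain ⟨a', x', y'⟩ := ℓ'
    simp only at ha hx hy
    subst ha; subst hx; subst hy
    rfl
  · right
    exact ⟨ha, by simpa only [pow_two] using hb⟩

theorem weakLive_of_weakLiveB {x y : Cell} (h : weakLiveB x y = true) : WeakLive x y := by
  simp only [weakLiveB, Bool.and_eq_true] at h
  obtain ⟨⟨⟨h0, h1⟩, h2⟩, h3⟩ := h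
  intro f
  fin_cases f
  · exact notDead_of_notDeadB h0
  · exact notDead_of_notDeadB h1
  · exact notDead_of_notDeadB h2
  · exact notDead_of_notDeadB h3


/-! ## §2 The design `C°` -/

/-- N-entries of `C°`: the heavy hub `31·hub⁴` and the 18 N-cells of the closure. -/
def CN : List (Cell × ℕ) := [
  (cellOf ⟨14, 0, 0⟩ ⟨14, 0, 0⟩ ⟨14, 0, 0⟩ ⟨14, 0, 0⟩, 31),
  (cellOf ⟨11, 1, 2⟩ ⟨14, 0, 0⟩ ⟨14, 0, 0⟩ ⟨14, 0, 0⟩, 1),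
  (cellOf ⟨12, 1, -1⟩ ⟨14, 0, 0⟩ ⟨14, 0, 0⟩ ⟨14, 0, 0⟩, 1),
  (cellOf ⟨12, 1, 1⟩ ⟨13, 1, 0⟩ ⟨14, 0, 0⟩ ⟨14, 0, 0⟩, 1),
  (cellOf ⟨12, 1, 1⟩ ⟨14, 0, 0⟩ ⟨13, 1, 0⟩ ⟨14, 0, 0⟩, 1),
  (cellOf ⟨12, 1, 1⟩ ⟨14, 0, 0⟩ ⟨14, 0, 0⟩ ⟨13, 1, 0⟩, 1),
  (cellOf ⟨13, 1, 0⟩ ⟨13, 1, 0⟩ ⟨13, 1, 0⟩ ⟨14, 0, 0⟩, 1),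
  (cellOf ⟨13, 1, 0⟩ ⟨13, 1, 0⟩ ⟨14, 0, 0⟩ ⟨13, 1, 0⟩, 1),
  (cellOf ⟨13, 1, 0⟩ ⟨14, 0, 0⟩ ⟨12, 2, 0⟩ ⟨14, 0, 0⟩, 1),
  (cellOf ⟨13, 1, 0⟩ ⟨14, 0, 0⟩ ⟨13, 1, 0⟩ ⟨13, 1, 0⟩, 1),
  (cellOf ⟨13, 1, 0⟩ ⟨14, 0, 0⟩ ⟨14, 0, 0⟩ ⟨12, 1, -1⟩, 1),
  (cellOf ⟨14, 0, 0⟩ ⟨12, 1, -1⟩ ⟨14, 0, 0⟩ ⟨14, 0, 0⟩, 1),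
  (cellOf ⟨14, 0, 0⟩ ⟨13, 1, 0⟩ ⟨12, 2, 0⟩ ⟨14, 0, 0⟩, 1),
  (cellOf ⟨14, 0, 0⟩ ⟨13, 1, 0⟩ ⟨13, 1, 0⟩ ⟨13, 1, 0⟩, 1),
  (cellOf ⟨14, 0, 0⟩ ⟨13, 1, 0⟩ ⟨14, 0, 0⟩ ⟨12, 1, -1⟩, 1),
  (cellOf ⟨14, 0, 0⟩ ⟨14, 0, 0⟩ ⟨12, 2, 0⟩ ⟨13, 1, 0⟩, 1),
  (cellOf ⟨14, 0, 0⟩ ⟨14, 0, 0⟩ ⟨13, 1, 0⟩ ⟨12, 1, -1⟩, 1),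
  (cellOf ⟨14, 0, 0⟩ ⟨14, 0, 0⟩ ⟨14, 0, 0⟩ ⟨11, 2, -1⟩, 1),
  (cellOf ⟨14, 0, 0⟩ ⟨14, 0, 0⟩ ⟨14, 0, 0⟩ ⟨12, 1, -1⟩, 1)
]

/-- P-entries of `C°`: the seed `u⁴` and the 22 P-cells of the closure. -/
def CP : List (Cell × ℕ) := [
  (cellOf ⟨11, 1, -2⟩ ⟨14, 0, 0⟩ ⟨14, 0, 0⟩ ⟨14, 0, 0⟩, 1),
  (cellOf ⟨11, 1, 2⟩ ⟨13, 1, 0⟩ ⟨14, 0, 0⟩ ⟨14, 0, 0⟩, 1),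
  (cellOf ⟨11, 1, 2⟩ ⟨14, 0, 0⟩ ⟨12, 2, 0⟩ ⟨14, 0, 0⟩, 1),
  (cellOf ⟨11, 1, 2⟩ ⟨14, 0, 0⟩ ⟨14, 0, 0⟩ ⟨13, 1, 0⟩, 1),
  (cellOf ⟨12, 1, -1⟩ ⟨14, 0, 0⟩ ⟨12, 2, 0⟩ ⟨14, 0, 0⟩, 1),
  (cellOf ⟨12, 1, 1⟩ ⟨13, 1, 0⟩ ⟨13, 1, 0⟩ ⟨14, 0, 0⟩, 1),
  (cellOf ⟨12, 1, 1⟩ ⟨13, 1, 0⟩ ⟨14, 0, 0⟩ ⟨13, 1, 0⟩, 1),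
  (cellOf ⟨12, 1, 1⟩ ⟨14, 0, 0⟩ ⟨13, 1, 0⟩ ⟨13, 1, 0⟩, 1),
  (cellOf ⟨12, 1, 1⟩ ⟨14, 0, 0⟩ ⟨14, 0, 0⟩ ⟨12, 1, -1⟩, 1),
  (cellOf ⟨13, 1, 0⟩ ⟨13, 1, 0⟩ ⟨12, 2, 0⟩ ⟨14, 0, 0⟩, 1),
  (cellOf ⟨13, 1, 0⟩ ⟨13, 1, 0⟩ ⟨13, 1, 0⟩ ⟨13, 1, 0⟩, 1),
  (cellOf ⟨13, 1, 0⟩ ⟨13, 1, 0⟩ ⟨14, 0, 0⟩ ⟨12, 1, -1⟩, 1),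
  (cellOf ⟨13, 1, 0⟩ ⟨14, 0, 0⟩ ⟨12, 2, 0⟩ ⟨13, 1, 0⟩, 1),
  (cellOf ⟨13, 1, 0⟩ ⟨14, 0, 0⟩ ⟨13, 1, 0⟩ ⟨12, 1, -1⟩, 1),
  (cellOf ⟨13, 1, 0⟩ ⟨14, 0, 0⟩ ⟨14, 0, 0⟩ ⟨11, 2, -1⟩, 1),
  (cellOf ⟨14, 0, 0⟩ ⟨11, 1, -2⟩ ⟨14, 0, 0⟩ ⟨14, 0, 0⟩, 1),
  (cellOf ⟨14, 0, 0⟩ ⟨12, 1, -1⟩ ⟨12, 2, 0⟩ ⟨14, 0, 0⟩, 1),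
  (cellOf ⟨14, 0, 0⟩ ⟨13, 1, 0⟩ ⟨12, 2, 0⟩ ⟨13, 1, 0⟩, 1),
  (cellOf ⟨14, 0, 0⟩ ⟨13, 1, 0⟩ ⟨13, 1, 0⟩ ⟨12, 1, -1⟩, 1),
  (cellOf ⟨14, 0, 0⟩ ⟨13, 1, 0⟩ ⟨14, 0, 0⟩ ⟨11, 2, -1⟩, 1),
  (cellOf ⟨14, 0, 0⟩ ⟨14, 0, 0⟩ ⟨12, 2, 0⟩ ⟨12, 1, -1⟩, 1),
  (cellOf ⟨14, 0, 0⟩ ⟨14, 0, 0⟩ ⟨13, 1, 0⟩ ⟨11, 2, -1⟩, 1),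
  (cellOf ⟨14, 0, 0⟩ ⟨14, 0, 0⟩ ⟨14, 0, 0⟩ ⟨11, 1, -2⟩, 1)
]

/-- `C°`, the cheap RULE-D closure of `u⁴` OFF the axis, at height 14. -/
def Ccirc : Design := ⟨CN, CP⟩

def hub4 : Cell := cellOf ⟨14, 0, 0⟩ ⟨14, 0, 0⟩ ⟨14, 0, 0⟩ ⟨14, 0, 0⟩

/-- an off-axis witness cell of the support. -/
def yo : Cell := cellOf ⟨11, 1, 2⟩ ⟨14, 0, 0⟩ ⟨14, 0, 0⟩ ⟨14, 0, 0⟩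

/-- the mixed word `1·1·1·e`. -/
def w1e : Word := ![Sym.one, Sym.one, Sym.one, Sym.e]

theorem hubE_mem : (hub4, 31) ∈ Ccirc.N := List.mem_cons_self

theorem yo_mem : (yo, 1) ∈ Ccirc.N := List.mem_cons_of_mem _ List.mem_cons_self

/-! ## §3 Tables (`decide +kernel`) -/

theorem closedN_C : closedB CN CP (fun x y g j => suppliesB x y g j) = true := by decide +kernel

theorem closedP_C : closedB CP CN (fun y x g j => suppliesB x y g j) = true := by decide +kernel

theorem alphaCN : allB CN (fun cm => onAlphaB 14 cm.1) = true := by decide +kernel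

theorem alphaCP : allB CP (fun cm => onAlphaB 14 cm.1) = true := by decide +kernel

theorem disjC_table : allB CN (fun cn => allB CP (fun cm => !cellEqB cm.1 cn.1)) = true := by decide +kernel

theorem hub_above_CP : allB CP (fun cm => weakLiveB cm.1 hub4) = true := by decide +kernel

theorem mu_rawC : rawT CN CP Word.eeee = (-1, 0) := by decide +kernel

theorem raw_w1e : rawT CN CP w1e = (-7, -5) := by decide +kernel

theorem copies_C : Ccirc.copies = 72 := by decide +kernel

theorem rank_C : Ccirc.rank = 26 := by decide +kernel

theorem massP_C : (Ccirc.P.map Prod.snd).sum = 23 := by decide +kernel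

theorem massN_C : (Ccirc.N.map Prod.snd).sum = 49 := by decide +kernel

theorem extPN_C_one : extPN Ccirc 1 = 0 := by decide +kernel
theorem extNP_C_three : extNP Ccirc 3 = 0 := by decide +kernel
theorem extNN_C_two : extNN Ccirc 2 = 0 := by decide +kernel
theorem extPP_C_two : extPP Ccirc 2 = 0 := by decide +kernel

/-! ## §4 The certificate -/

theorem onAlphabet_C : Ccirc.OnAlphabet 14 := by
  intro c hc f
  rcases List.mem_append.1 hc with hN | hP
  · obtain ⟨m, hm⟩ := exists_of_mem_suppN hN
    exact onAlphabet_of_B ((allB_iff _ _).1 alphaCN (c, m) hm) f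
  · obtain ⟨m, hm⟩ := exists_of_mem_suppP hP
    exact onAlphabet_of_B ((allB_iff _ _).1 alphaCP (c, m) hm) f

theorem yo_suppN : yo ∈ Ccirc.suppN := mem_suppN_of yo_mem (by decide)

/-- `C°` is NOT in the axis room. -/
theorem not_axisRoom_C : ¬ AxisRoom Ccirc := by
  intro hR
  have h := hR yo (List.mem_append_left _ yo_suppN) 0
  unfold Letter.isAxis at h
  revert h
  decide

theorem disj_C : Disj Ccirc := by
  intro c hN hP
  obtain ⟨n, hn⟩ := exists_of_mem_suppN hN
  obtain ⟨m, hm⟩ := exists_of_mem_suppP hP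
  have h1 := (allB_iff _ _).1 ((allB_iff _ _).1 disjC_table (c, n) hn) (c, m) hm
  rw [cellEqB_self] at h1
  exact Bool.noConfusion h1

/-- **`C°` satisfies RULE D** (both clauses), by the sound raw checker. -/
theorem ruleD_C : RuleD Ccirc := ruleD_of_B Ccirc closedN_C closedP_C

/-- **`C°` satisfies PortHall₈** by the heavy hub alone (`31 = 23 + 8`). -/
theorem hallPlusUp8_C : HallPlusUp Ccirc 8 := by
  intro S hS hpos T hT hcov
  obtain ⟨cm, hcm⟩ : ∃ cm, cm ∈ S := by
    cases S with
    | nil => simp at hpos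
    | cons a l => exact ⟨a, List.mem_cons_self⟩
  have hhub : (hub4, 31) ∈ T :=
    hcov _ hubE_mem ⟨cm, hcm, weakLive_of_weakLiveB ((allB_iff _ _).1 hub_above_CP cm (hS.subset hcm))⟩
  have h31 : 31 ≤ (T.map Prod.snd).sum :=
    List.single_le_sum (fun a _ => Nat.zero_le a) 31 (List.mem_map.2 ⟨(hub4, 31), hhub, rfl⟩)
  have hle : (S.map Prod.snd).sum ≤ (Ccirc.P.map Prod.snd).sum := (hS.map Prod.snd).sum_le_sum (fun a _ => Nat.zero_le a)
  rw [massP_C] at hle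
  omega

theorem hallUp_C : HallUp Ccirc := hallUp_of_hallPlusUp Ccirc 8 hallPlusUp8_C

theorem T_closedC (w : Word) : Ccirc.T w = toG (rawT CN CP w) := T_raw Ccirc w

theorem mu_C : Ccirc.mu = ⟨-1, 0⟩ := by
  show Ccirc.T Word.eeee = _
  rw [T_closedC, mu_rawC]
  rfl

theorem mu_ne_C : Ccirc.mu ≠ 0 := by
  rw [mu_C]
  decide

theorem T_w1e_C : Ccirc.T w1e = ⟨-7, -5⟩ := by
  rw [T_closedC, raw_w1e]
  rfl

/-- **`C°` is NOT (A1)-clean**: the mixed word `1·1·1·e` does not vanish. -/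
theorem not_a1_C : ¬ Ccirc.A1 := by
  intro h
  have hmv := ((a1_iff Ccirc).1 h).1
  have hne : ¬ w1e.efree := fun he => absurd (he 3) (by decide)
  have h1 : w1e ≠ Word.eeee := fun he => absurd (congrFun he 0) (by decide)
  have h2 : w1e ≠ Word.EEEE := fun he => absurd (congrFun he 0) (by decide)
  have h0 := hmv w1e hne h1 h2
  rw [T_w1e_C] at h0
  exact absurd h0 (by decide)

theorem sigmaH_C : sigmaH Ccirc = 2016 := by
  unfold sigmaH
  rw [copies_C, extPN_C_one, extNP_C_three, extNN_C_two, extPP_C_two]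
  norm_num

theorem budget_C : BudgetClause sigmaH 0 Ccirc := by
  unfold BudgetClause
  rw [sigmaH_C, rank_C]
  norm_num

/-- **THE CERTIFICATE OF `C°`**: every binder of `SPlus 14 σ_H 0` — `RuleD`, PortHall₈ and the Σ-budget included — except (A1), OFF the
axis room, at N-mass `49 ≤ 58`. -/
theorem cert_C : Ccirc.OnAlphabet 14 ∧ ¬ AxisRoom Ccirc ∧ Disj Ccirc ∧ RuleD Ccirc ∧ HallUp Ccirc ∧ HallPlusUp Ccirc 8 ∧
    Ccirc.mu = ⟨-1, 0⟩ ∧ Ccirc.rank = 26 ∧ Ccirc.copies = 72 ∧ (Ccirc.N.map Prod.snd).sum = 49 ∧ sigmaH Ccirc = 2016 ∧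
    BudgetClause sigmaH 0 Ccirc ∧ ¬ Ccirc.A1 :=
  ⟨onAlphabet_C, not_axisRoom_C, disj_C, ruleD_C, hallUp_C, hallPlusUp8_C, mu_C, rank_C, copies_C, massN_C, sigmaH_C, budget_C, not_a1_C⟩

/-- **(A1) IS NECESSARY OFF THE AXIS**: the (A1)-free version of the door sentence is FALSE off the axis room, at N-mass `49 ≤ 58`. -/
theorem not_a1free_door_offAxis :
    ¬ (∀ D : Design, D.OnAlphabet 14 → ¬ AxisRoom D → Disj D → RuleD D → HallUp D → HallPlusUp D 8 → D.mu ≠ 0 →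
        BudgetClause sigmaH 0 D → False) :=
  fun h => h Ccirc onAlphabet_C not_axisRoom_C disj_C ruleD_C hallUp_C hallPlusUp8_C mu_ne_C budget_C

/-- the three OFF-AXIS necessity witnesses in one line (with `OffAxisTwin`): (A1) necessary (`C°`, here); `RuleD` necessary (`D°`, `D◇`,
there); the budget clause is what caps N-mass at 58 (`AxisSPlus.nmass_le_58_of_budget`).  The door itself, off the axis, stays OPEN. -/
theorem offAxis_a1_necessary : ∃ D : Design, D.OnAlphabet 14 ∧ ¬ AxisRoom D ∧ Disj D ∧ RuleD D ∧ HallPlusUp D 8 ∧ D.mu ≠ 0 ∧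
    BudgetClause sigmaH 0 D ∧ (D.N.map Prod.snd).sum ≤ 58 ∧ ¬ D.A1 :=
  ⟨Ccirc, onAlphabet_C, not_axisRoom_C, disj_C, ruleD_C, hallPlusUp8_C, mu_ne_C, budget_C, by rw [massN_C]; decide, not_a1_C⟩

end Summit.HodgeConjecture.HodgeConjecture.Cruxes.BlochSeedDiscOne.OffAxisCheap
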